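import Literature.MathematicalPhysics.QuantumFieldTheory.Balaban1983to89.B14Claim283RBound
import Literature.MathematicalPhysics.QuantumFieldTheory.Balaban1983to89.B12Repr43
import Literature.MathematicalPhysics.QuantumFieldTheory.Balaban1983to89.B12CauchyRemainder354

/-!
# `Balaban1983to89.B14Claim283RAnalytic` — [Balaban1988Convergent] p. 283, the 𝐑-side claim of the proof of (2.44):
the tower sizes FROM ANALYTICITY AND THE BOUND (2.31), by the Cauchy estimates of [I] (4.3)–(4.5) and (3.54)

HONEST FRAMING (cell `lit-balaban`, verbatim): statement-level skeleton of published theorems with citation tags; proofs where landed; nothing here is a claim about the Yang–Mills mass gap.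

CITATION HEADER.  T. Bałaban, *Convergent renormalization expansions for lattice gauge theories*, Commun. Math.
Phys. **119** (1988) 243–285, doi:10.1007/bf01217741 [Balaban1988Convergent] (cell paper B14 = "[III]"; renders
`b2b-balaban-ref1/pages/1988-cmp119-convergent-renormalization/…-pNNN-x2.png`, PDF page = journal page − 242), p. 283
[PDF 41] (the 𝐑-side sentence of the proof of Theorem 2), p. 259 [PDF 17] (properties (i)–(iv) after (2.27)) and p. 260
[PDF 18] ((2.30)–(2.31)); T. Bałaban, *Renormalization group approach to lattice gauge field theories. I*, Commun.
Math. Phys. **109** (1987) 249–301 [Balaban1987RG1] = "[I]", (4.3)–(4.5) pp. 281–282 (the iterated Cauchy estimate of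
the `n`-th derivative) and (3.54) p. 280 (the Cauchy estimate of the fifth-order Taylor remainder).  Unit
`lit-balaban-r11` gen 10 (fold owner of B14), SKELETON rows `B14.Claim@283R` (this file), `B14.Eq2.31`, `B14.Thm2`.

WHAT IS PRINTED.  p. 260 [PDF 18], on the terms `𝐑^{(j)}(X, U_k)` of (2.30): *«Terms of this representation have the
properties (i)–(iii) formulated above, after (2.27)»* — p. 259: *«(ii) there exists an analytic function … of the
variables (𝐔, 𝐉) ∈ U^c_j(X, α_{0,j}, α_{1,j}), which is an extension of this term …; (iii) the extended function is
invariant with respect to the gauge transformations (I.1.10)»* — *«The property (iv) is different now; we assume that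
the following stronger inequality holds:
    |𝐑^{(j)}(X, (𝐔, 𝐉))| ≦ g_j^{κ₀} exp(−κd_j(X)).   (2.31)»*
p. 283 [PDF 41]: *«Using the same analysis as in the above proof we stop at the identity (3.49), where 𝐄^{(2)}(X, x, y,
z) is replaced by 𝐑^{(2)}(X, x, y), and z is an arbitrary point of the domain X, all the terms on the right-hand side
can be bounded by O(1)(LʲL⁻ⁿ)⁴g_j^{κ₀} exp(−κd_j(X)), and this yields the inequality (2.44).»*  The O(1) is the
product of the field scalings of [I] (4.16)–(4.18) with the SIZES of the derivative towers `𝐑^{(n)} = ⟨δⁿ𝐑/δBⁿ(0), ·⟩`,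
and in print those sizes come from analyticity (ii) and the bound (2.31) by the iterated Cauchy integral of [I] (4.3),
third and fourth members, estimated as in (4.5) p. 282 (*«≦ (2n²B₃α₂⁻¹)ⁿ E₀ exp(−κd_j(X)) …»*), the fifth-order
Taylor remainder by the Cauchy estimate (3.54) p. 280.

WHAT THIS FILE PROVES (theorems only; no definition, no new hypothesis-as-fact).  The companion file
`…B14Claim283RBound` (gen 10) derived the p. 283 bound with the tower sizes `e₂, e₃, e₄` and the fifth-order remainder
size `e₅` as LETTERS.  Here they are DISCHARGED from the printed inputs (ii) + (2.31) read in the chart `B ↦ f(B)`: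
`f` complex-analytic on the ball `‖B‖ < α` and `‖f‖ ≤ S` there (`S = g_j^{κ₀}exp(−κd_j(X))`):
* §1 (private helpers `fderiv_real_apply`, `fderiv₂_real_apply`, `fderiv₃_real_apply`, `fderiv₄_real_apply`): for
  a complex-analytic `f` the REAL nested Fréchet derivatives of the tree's (3.49)-files (`fderiv ℝ (fderiv ℝ f) x u v`,
  …, stated over `ℝ` because the Lie-algebra calculus of [I] §4 is real) ARE the complex ones — restriction of
  scalars, one derivative at a time (folklore plumbing, kept private);
* §2 `norm_fderiv₂_le`/`norm_fderiv₃_le`/`norm_fderiv₄_le` (+ `_real` forms): the Cauchy sizes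
  `‖D²f(0)(u,v)‖ ≤ S(4/α)²‖u‖‖v‖`, `‖D³f(0)(u,v,w)‖ ≤ S(6/α)³‖u‖‖v‖‖w‖`, `‖D⁴f(0)(u,v,w,x)‖ ≤ S(8/α)⁴Π‖·‖` — BY NAME from
  the tree's iterated Cauchy estimate `…B12Repr43.norm_iteratedFDeriv_apply_le_of_ball` ([I] (4.3)–(4.5), constant
  `(2n/α)ⁿ`);
* §3 `taylor5_remainder_real_norm_le`: `‖f(B) − f(0) − Σ_{n=1}^{4}(1/n!)Dⁿf(0)(B,…,B)‖ ≤ 32Sα⁻⁵‖B‖⁵` for `‖B‖ ≤ α/2` —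
  BY NAME from `…B12CauchyRemainder354.taylor5_remainder_norm_le` ((3.54), contour radius `α/(2‖B‖)`) and
  `…B14.Eq349WardReduction.taylor4_diag_eq`;
* §4 `taylor4_chart_norm_le_of_analytic`, `diff_chart_norm_le_of_analytic`, `diff_chart_norm_le_coupling_of_analytic`:
  the p. 283 claim in the chart `f(B) = 𝓡(exp ρB)` of a gauge-invariant `C⁴` functional with semisimple charge algebra
  (`…B14.Claim283RBound.taylor4_chart_norm_le_of_isSemisimple`, whose Ward–Takahashi inputs are theorems of the tree)
  with NO lettered tower size left: every term of the right-hand side of (3.49)-with-𝐑^{(2)}, and the whole difference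
  `f(B) − f(0)` (model: `𝐑^{(j)}(X, U_k) − 𝐑^{(j)}(X, 1)`), is `≤ C(a, b, α)·(LʲL⁻ⁿ)⁴·S`, `S = g_j^{κ₀}exp(−κd_j(X))`, with
  `C` an explicit polynomial in the field-scaling constant `a` of (I.4.16)–(I.4.18), the bracket bound `b` and `α⁻¹`.

* §4 (𝐄-side twin) `remainder349_chart_norm_le_of_analytic`: the fourteen REMAINDER terms of (3.49) in the chart
  (`…Eq349WardReduction.remainder349_norm_le`, pure power counting) `≤ K(a, b, α, S)·σ⁴τ` with the same explicit sizes
  — for 𝐄^{(j)}(X, ·, z) the inputs are (2.27)(ii) + (iv) = (I.1.18) (`S = E₀exp(−κd_j(X))`), p. 281 «O((LʲL⁻ⁿ)^{5−β})».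

HONEST SCOPE.  (1) The hypotheses `hf`/`hS` are (ii) + (2.31) IN THE CHART: analyticity and the bound on a ball of
Lie-algebra fields `B` around the background (the chart preimage of `U^c_j(X, α_{0,j}, α_{1,j})`), not on Bałaban's
configuration space itself; the radius `α` is a letter (a function of `α_{0,j}, α_{1,j}`, cf. the (4.4)-radius `α₂` of
[I]).  (2) The field-piece scalings `‖B(z)‖, ‖λ‖ ≤ aσ`, `‖B(·,z)‖ ≤ aσ²`, `‖remainder‖ ≤ aσ²τ` (`σ = LʲL⁻ⁿ ≤ τ ≤ 1`, `τ = σ^β` the Hölder factor of (I.4.18) read «in the L⁻ⁿ-scale» p. 280, as in `…Eq349WardReduction` §3; v1.1 docfix: v1 glossed `τ` as `LʲL⁻ᵏ`, a slip — the hypotheses were always `σ ≤ τ ≤ 1`)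
are [I] (4.16)–(4.18), taken as hypotheses as in the companion file; `‖B‖ ≤ α/2` is print's «for g_j sufficiently
small».  (3) Bałaban's concrete `𝐑^{(j)}` is not instantiated on one carrier (row head policy G.5-45 unchanged).
(4) Cauchy constants: the tree's `(2n/α)ⁿ` (polydisc inside the ball of radius `α/2`), weaker than optimal, as print's
O(1).  Nothing about the Yang–Mills mass gap.
-/

open Set Metric Filter
open scoped Topology

namespace Literature.MathematicalPhysics.QuantumFieldTheory.Balaban1983to89.B14.Claim283RAnalytic

open Literature.MathematicalPhysics.QuantumFieldTheory.Balaban1983to89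

/-! ## §1. Real versus complex nested Fréchet derivatives of a complex-analytic map -/

section RealComplex

variable {E : Type*} [NormedAddCommGroup E] [NormedSpace ℂ E] [NormedSpace ℝ E] [IsScalarTower ℝ ℂ E]
  {F : Type*} [NormedAddCommGroup F] [NormedSpace ℂ F] [CompleteSpace F]

/-- One derivative at a time: if `g' = R ∘ g` on an open `U` with `g` complex-differentiable and `R` real-linear
continuous, then `D_ℝ g'(x)u = R(D_ℂ g(x)u)` on `U`. [folklore] -/
private theorem fderiv_real_apply_of_eqOn {G H : Type*} [NormedAddCommGroup G] [NormedSpace ℂ G]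
    [NormedSpace ℝ G] [IsScalarTower ℝ ℂ G] [NormedAddCommGroup H] [NormedSpace ℝ H] {U : Set E}
    (hU : IsOpen U) {g : E → G} (hg : DifferentiableOn ℂ g U) (R : G →L[ℝ] H) {g' : E → H}
    (heq : EqOn g' (fun x => R (g x)) U) {x : E} (hx : x ∈ U) (u : E) :
    fderiv ℝ g' x u = R (fderiv ℂ g x u) := by
  have hxU : U ∈ 𝓝 x := hU.mem_nhds hx
  have h1 : fderiv ℝ g' x = fderiv ℝ (fun x => R (g x)) x := (heq.eventuallyEq_of_mem hxU).fderiv_eq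
  have h2 : HasFDerivAt (fun x => R (g x)) (R.comp ((fderiv ℂ g x).restrictScalars ℝ)) x :=
    R.hasFDerivAt.comp x (((hg x hx).differentiableAt hxU).hasFDerivAt.restrictScalars ℝ)
  rw [h1, h2.fderiv]
  rfl

omit [CompleteSpace F] in
/-- **First derivative**: for `f` complex-analytic on an open `U ∋ x`, `D_ℝf(x)u = D_ℂf(x)u`. [folklore] -/
private theorem fderiv_real_apply {U : Set E} {f : E → F} (hf : AnalyticOnNhd ℂ f U) {x : E} (hx : x ∈ U) (u : E) :
    fderiv ℝ f x u = fderiv ℂ f x u := by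
  rw [((hf x hx).differentiableAt.hasFDerivAt.restrictScalars ℝ).fderiv]
  rfl

/-- **Second derivative**: `D²_ℝf(x)(u,v) = D²_ℂf(x)(u,v)` (the nested form `fderiv ℝ (fderiv ℝ f) x u v` of the
(3.49)-files). [folklore] -/
private theorem fderiv₂_real_apply {U : Set E} (hU : IsOpen U) {f : E → F} (hf : AnalyticOnNhd ℂ f U) {x : E} (hx : x ∈ U)
    (u v : E) : fderiv ℝ (fderiv ℝ f) x u v = fderiv ℂ (fderiv ℂ f) x u v := by
  have heq : EqOn (fderiv ℝ f) (fun y => ContinuousLinearMap.restrictScalarsL ℂ E F ℝ ℝ (fderiv ℂ f y)) U :=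
    fun y hy => by
      ext w
      exact fderiv_real_apply hf hy w
  rw [fderiv_real_apply_of_eqOn hU hf.fderiv.differentiableOn _ heq hx u]
  rfl

-- (the nested operator spaces over `E`: one more level of pending instance synthesis)
set_option maxSynthPendingDepth 3 in
/-- **Third derivative**: `D³_ℝf(x)(u,v,w) = D³_ℂf(x)(u,v,w)`. [folklore] -/
private theorem fderiv₃_real_apply {U : Set E} (hU : IsOpen U) {f : E → F} (hf : AnalyticOnNhd ℂ f U) {x : E} (hx : x ∈ U)
    (u v w : E) :
    fderiv ℝ (fderiv ℝ (fderiv ℝ f)) x u v w = fderiv ℂ (fderiv ℂ (fderiv ℂ f)) x u v w := by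
  let R₁ : (E →L[ℂ] F) →L[ℝ] (E →L[ℝ] F) := ContinuousLinearMap.restrictScalarsL ℂ E F ℝ ℝ
  let R₂ : (E →L[ℂ] E →L[ℂ] F) →L[ℝ] (E →L[ℝ] E →L[ℝ] F) :=
    (ContinuousLinearMap.compL ℝ E (E →L[ℂ] F) (E →L[ℝ] F) R₁).comp
      (ContinuousLinearMap.restrictScalarsL ℂ E (E →L[ℂ] F) ℝ ℝ)
  have hR₂ : ∀ (M : E →L[ℂ] E →L[ℂ] F) (p q : E), R₂ M p q = M p q := fun _ _ _ => rfl
  have heq : EqOn (fderiv ℝ (fderiv ℝ f)) (fun y => R₂ (fderiv ℂ (fderiv ℂ f) y)) U := fun y hy => by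
    ext p q
    rw [hR₂]
    exact fderiv₂_real_apply hU hf hy p q
  rw [fderiv_real_apply_of_eqOn hU hf.fderiv.fderiv.differentiableOn R₂ heq hx u]
  exact hR₂ _ v w

-- (the nested operator spaces over `E`: more levels of pending instance synthesis)
set_option maxSynthPendingDepth 4 in
/-- **Fourth derivative**: `D⁴_ℝf(x)(u,v,w,x') = D⁴_ℂf(x)(u,v,w,x')`. [folklore] -/
private theorem fderiv₄_real_apply {U : Set E} (hU : IsOpen U) {f : E → F} (hf : AnalyticOnNhd ℂ f U) {x : E} (hx : x ∈ U)
    (u v w x' : E) :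
    fderiv ℝ (fderiv ℝ (fderiv ℝ (fderiv ℝ f))) x u v w x'
      = fderiv ℂ (fderiv ℂ (fderiv ℂ (fderiv ℂ f))) x u v w x' := by
  let R₁ : (E →L[ℂ] F) →L[ℝ] (E →L[ℝ] F) := ContinuousLinearMap.restrictScalarsL ℂ E F ℝ ℝ
  let R₂ : (E →L[ℂ] E →L[ℂ] F) →L[ℝ] (E →L[ℝ] E →L[ℝ] F) :=
    (ContinuousLinearMap.compL ℝ E (E →L[ℂ] F) (E →L[ℝ] F) R₁).comp
      (ContinuousLinearMap.restrictScalarsL ℂ E (E →L[ℂ] F) ℝ ℝ)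
  let R₃ : (E →L[ℂ] E →L[ℂ] E →L[ℂ] F) →L[ℝ] (E →L[ℝ] E →L[ℝ] E →L[ℝ] F) :=
    (ContinuousLinearMap.compL ℝ E (E →L[ℂ] E →L[ℂ] F) (E →L[ℝ] E →L[ℝ] F) R₂).comp
      (ContinuousLinearMap.restrictScalarsL ℂ E (E →L[ℂ] E →L[ℂ] F) ℝ ℝ)
  have hR₃ : ∀ (M : E →L[ℂ] E →L[ℂ] E →L[ℂ] F) (p q s : E), R₃ M p q s = M p q s := fun _ _ _ _ => rfl
  have heq : EqOn (fderiv ℝ (fderiv ℝ (fderiv ℝ f))) (fun y => R₃ (fderiv ℂ (fderiv ℂ (fderiv ℂ f)) y)) U :=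
    fun y hy => by
      ext p q s
      rw [hR₃]
      exact fderiv₃_real_apply hU hf hy p q s
  rw [fderiv_real_apply_of_eqOn hU hf.fderiv.fderiv.fderiv.differentiableOn R₃ heq hx u]
  exact hR₃ _ v w x'

end RealComplex

/-! ## §2. The Cauchy sizes of the towers `D²f(0)`, `D³f(0)`, `D⁴f(0)` from analyticity and the bound on a ball -/

section Sizes

variable {E : Type*} [NormedAddCommGroup E] [NormedSpace ℂ E] {F : Type*} [NormedAddCommGroup F]
  [NormedSpace ℂ F] [CompleteSpace F]

omit [CompleteSpace F] in
/-- `D³f(z)[m] = ∂_{m 0}∂_{m 1}∂_{m 2}` in nested form (complex twin of `…B12WardSecond415.iteratedFDeriv_three_apply`).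
[folklore] -/
private theorem iteratedFDeriv_three_apply' (f : E → F) (z : E) (m : Fin 3 → E) :
    iteratedFDeriv ℂ 3 f z m = fderiv ℂ (fderiv ℂ (fderiv ℂ f)) z (m 0) (m 1) (m 2) := by
  rw [iteratedFDeriv_succ_apply_right, iteratedFDeriv_two_apply]
  rfl

omit [CompleteSpace F] in
/-- `D⁴f(z)[m]` in nested form (complex twin of `…B12WardThird415.iteratedFDeriv_four_apply`). [folklore] -/
private theorem iteratedFDeriv_four_apply' (f : E → F) (z : E) (m : Fin 4 → E) :
    iteratedFDeriv ℂ 4 f z m = fderiv ℂ (fderiv ℂ (fderiv ℂ (fderiv ℂ f))) z (m 0) (m 1) (m 2) (m 3) := by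
  rw [iteratedFDeriv_succ_apply_right, iteratedFDeriv_three_apply']
  rfl

/-- **Size of `𝐑^{(2)}`** ([I] (4.5) at `n = 2`; for (3.49): the letter `e₂`): `f` analytic on `‖y‖ < α` with `‖f‖ ≤ S`
there ⇒ `‖D²f(0)(u,v)‖ ≤ S(4/α)²‖u‖‖v‖`. [cite: Balaban1987RG1, (4.3)–(4.5) pp.281–282; Balaban1988Convergent, (2.31) p.260] -/
theorem norm_fderiv₂_le {α S : ℝ} (hα : 0 < α) {f : E → F} (hf : AnalyticOnNhd ℂ f (ball 0 α))
    (hS : ∀ y ∈ ball (0 : E) α, ‖f y‖ ≤ S) (u v : E) :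
    ‖fderiv ℂ (fderiv ℂ f) 0 u v‖ ≤ S * (4 / α) ^ 2 * ‖u‖ * ‖v‖ := by
  have h := B12Repr43.norm_iteratedFDeriv_apply_le_of_ball isOpen_ball hα Subset.rfl hf hS ![u, v]
    (fun p => ‖(![u, v] : Fin 2 → E) p‖) (fun _ => norm_nonneg _) (fun _ => le_rfl)
  rw [iteratedFDeriv_two_apply] at h
  simp only [Fin.prod_univ_two, Matrix.cons_val_zero, Matrix.cons_val_one] at h
  calc ‖fderiv ℂ (fderiv ℂ f) 0 u v‖ ≤ S * (2 * 2 / α) ^ 2 * (‖u‖ * ‖v‖) := h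
    _ = S * (4 / α) ^ 2 * ‖u‖ * ‖v‖ := by norm_num; ring

/-- **Size of `𝐑^{(3)}`** (the letter `e₃`): `‖D³f(0)(u,v,w)‖ ≤ S(6/α)³‖u‖‖v‖‖w‖`.
[cite: Balaban1987RG1, (4.3)–(4.5) pp.281–282; Balaban1988Convergent, (2.31) p.260] -/
theorem norm_fderiv₃_le {α S : ℝ} (hα : 0 < α) {f : E → F} (hf : AnalyticOnNhd ℂ f (ball 0 α))
    (hS : ∀ y ∈ ball (0 : E) α, ‖f y‖ ≤ S) (u v w : E) :
    ‖fderiv ℂ (fderiv ℂ (fderiv ℂ f)) 0 u v w‖ ≤ S * (6 / α) ^ 3 * ‖u‖ * ‖v‖ * ‖w‖ := by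
  have h := B12Repr43.norm_iteratedFDeriv_apply_le_of_ball isOpen_ball hα Subset.rfl hf hS ![u, v, w]
    (fun p => ‖(![u, v, w] : Fin 3 → E) p‖) (fun _ => norm_nonneg _) (fun _ => le_rfl)
  rw [iteratedFDeriv_three_apply'] at h
  simp only [Fin.prod_univ_three, Matrix.cons_val_zero, Matrix.cons_val_one, Matrix.cons_val_two] at h
  calc ‖fderiv ℂ (fderiv ℂ (fderiv ℂ f)) 0 u v w‖ ≤ S * (2 * 3 / α) ^ 3 * (‖u‖ * ‖v‖ * ‖w‖) := h
    _ = S * (6 / α) ^ 3 * ‖u‖ * ‖v‖ * ‖w‖ := by norm_num; ring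

/-- **Size of `𝐑^{(4)}`** (the letter `e₄`): `‖D⁴f(0)(u,v,w,x)‖ ≤ S(8/α)⁴‖u‖‖v‖‖w‖‖x‖`.
[cite: Balaban1987RG1, (4.3)–(4.5) pp.281–282; Balaban1988Convergent, (2.31) p.260] -/
theorem norm_fderiv₄_le {α S : ℝ} (hα : 0 < α) {f : E → F} (hf : AnalyticOnNhd ℂ f (ball 0 α))
    (hS : ∀ y ∈ ball (0 : E) α, ‖f y‖ ≤ S) (u v w x : E) :
    ‖fderiv ℂ (fderiv ℂ (fderiv ℂ (fderiv ℂ f))) 0 u v w x‖ ≤ S * (8 / α) ^ 4 * ‖u‖ * ‖v‖ * ‖w‖ * ‖x‖ := by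
  have h := B12Repr43.norm_iteratedFDeriv_apply_le_of_ball isOpen_ball hα Subset.rfl hf hS ![u, v, w, x]
    (fun p => ‖(![u, v, w, x] : Fin 4 → E) p‖) (fun _ => norm_nonneg _) (fun _ => le_rfl)
  rw [iteratedFDeriv_four_apply'] at h
  simp only [Fin.prod_univ_four, Matrix.cons_val_zero, Matrix.cons_val_one, Matrix.cons_val_two,
    Matrix.cons_val] at h
  calc ‖fderiv ℂ (fderiv ℂ (fderiv ℂ (fderiv ℂ f))) 0 u v w x‖
      ≤ S * (2 * 4 / α) ^ 4 * (‖u‖ * ‖v‖ * ‖w‖ * ‖x‖) := h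
    _ = S * (8 / α) ^ 4 * ‖u‖ * ‖v‖ * ‖w‖ * ‖x‖ := by norm_num; ring

variable [NormedSpace ℝ E] [IsScalarTower ℝ ℂ E]

/-- §2 in the REAL nested form of the (3.49)-files: `‖D²_ℝf(0)(u,v)‖ ≤ S(4/α)²‖u‖‖v‖`.
[cite: Balaban1987RG1, (4.3)–(4.5) pp.281–282; Balaban1988Convergent, (2.31) p.260] -/
theorem norm_fderiv₂_real_le {α S : ℝ} (hα : 0 < α) {f : E → F} (hf : AnalyticOnNhd ℂ f (ball 0 α))
    (hS : ∀ y ∈ ball (0 : E) α, ‖f y‖ ≤ S) (u v : E) :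
    ‖fderiv ℝ (fderiv ℝ f) 0 u v‖ ≤ S * (4 / α) ^ 2 * ‖u‖ * ‖v‖ := by
  rw [fderiv₂_real_apply isOpen_ball hf (mem_ball_self hα)]
  exact norm_fderiv₂_le hα hf hS u v

/-- Real nested form: `‖D³_ℝf(0)(u,v,w)‖ ≤ S(6/α)³‖u‖‖v‖‖w‖`.
[cite: Balaban1987RG1, (4.3)–(4.5) pp.281–282; Balaban1988Convergent, (2.31) p.260] -/
theorem norm_fderiv₃_real_le {α S : ℝ} (hα : 0 < α) {f : E → F} (hf : AnalyticOnNhd ℂ f (ball 0 α))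
    (hS : ∀ y ∈ ball (0 : E) α, ‖f y‖ ≤ S) (u v w : E) :
    ‖fderiv ℝ (fderiv ℝ (fderiv ℝ f)) 0 u v w‖ ≤ S * (6 / α) ^ 3 * ‖u‖ * ‖v‖ * ‖w‖ := by
  rw [fderiv₃_real_apply isOpen_ball hf (mem_ball_self hα)]
  exact norm_fderiv₃_le hα hf hS u v w

/-- Real nested form: `‖D⁴_ℝf(0)(u,v,w,x)‖ ≤ S(8/α)⁴‖u‖‖v‖‖w‖‖x‖`.
[cite: Balaban1987RG1, (4.3)–(4.5) pp.281–282; Balaban1988Convergent, (2.31) p.260] -/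
theorem norm_fderiv₄_real_le {α S : ℝ} (hα : 0 < α) {f : E → F} (hf : AnalyticOnNhd ℂ f (ball 0 α))
    (hS : ∀ y ∈ ball (0 : E) α, ‖f y‖ ≤ S) (u v w x : E) :
    ‖fderiv ℝ (fderiv ℝ (fderiv ℝ (fderiv ℝ f))) 0 u v w x‖ ≤ S * (8 / α) ^ 4 * ‖u‖ * ‖v‖ * ‖w‖ * ‖x‖ := by
  rw [fderiv₄_real_apply isOpen_ball hf (mem_ball_self hα)]
  exact norm_fderiv₄_le hα hf hS u v w x

end Sizes

/-! ## §3. The fifth-order Taylor remainder from (3.54) of [I], in the real nested form -/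

section Remainder

variable {E : Type*} [NormedAddCommGroup E] [NormedSpace ℂ E] [NormedSpace ℝ E] [IsScalarTower ℝ ℂ E]
  {F : Type*} [NormedAddCommGroup F] [NormedSpace ℂ F] [CompleteSpace F]

/-- **The dropped term of (3.49): the fifth-order Taylor remainder** (print: the last term of (I.3.34), bounded by the
Cauchy estimate (I.3.54) on the circle of radius `α/(2‖B‖)`): for `f` analytic on `‖y‖ < α`, `‖f‖ ≤ S` there, and
`‖B‖ ≤ α/2`,
`‖f(B) − f(0) − [Df(0)B + ½D²f(0)(B,B) + ⅙D³f(0)(B,B,B) + (1/24)D⁴f(0)(B,B,B,B)]‖ ≤ 32Sα⁻⁵‖B‖⁵` — the letter `e₅` of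
`…B14.Claim283RBound.diff_norm_le` is `32S/α⁵`. [cite: Balaban1987RG1, (3.34) p.277, (3.54) p.280;
Balaban1988Convergent, (3.49) p.280, (2.31) p.260] -/
theorem taylor5_remainder_real_norm_le {α S : ℝ} (hα : 0 < α) {f : E → F} (hf : AnalyticOnNhd ℂ f (ball 0 α))
    (hS : ∀ y ∈ ball (0 : E) α, ‖f y‖ ≤ S) {B : E} (hBα : ‖B‖ ≤ α / 2) :
    ‖f B - f 0 - (fderiv ℝ f 0 B + (2 : ℝ)⁻¹ • fderiv ℝ (fderiv ℝ f) 0 B B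
        + (6 : ℝ)⁻¹ • fderiv ℝ (fderiv ℝ (fderiv ℝ f)) 0 B B B
        + (24 : ℝ)⁻¹ • fderiv ℝ (fderiv ℝ (fderiv ℝ (fderiv ℝ f))) 0 B B B B)‖
      ≤ 32 * S / α ^ 5 * ‖B‖ ^ 5 := by
  have hS0 : 0 ≤ S := (norm_nonneg _).trans (hS 0 (mem_ball_self hα))
  by_cases hB0 : B = 0
  · subst hB0
    simp only [map_zero, smul_zero, add_zero, sub_self, norm_zero]
    positivity
  have hnB : 0 < ‖B‖ := norm_pos_iff.mpr hB0
  set r : ℝ := α / (2 * ‖B‖) with hr_def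
  have hr : 0 < r := by positivity
  have hf5 : ContDiffOn ℝ 5 f (ball 0 α) := (hf.contDiffOn_of_completeSpace (n := 5)).restrict_scalars ℝ
  have hseg : ∀ τ ∈ Icc (0 : ℝ) 1, τ • B ∈ ball (0 : E) α := fun τ hτ => by
    rw [mem_ball_zero_iff, norm_smul, Real.norm_eq_abs, abs_of_nonneg hτ.1]
    calc τ * ‖B‖ ≤ 1 * ‖B‖ := by gcongr; exact hτ.2
      _ < α := by linarith
  have hin : ∀ τ ∈ Icc (0 : ℝ) 1, ∀ z ∈ ball (τ : ℂ) r, z • B ∈ ball (0 : E) α := by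
    intro τ hτ z hz
    rw [mem_ball_zero_iff, norm_smul]
    have hτn : ‖(τ : ℂ)‖ ≤ 1 := by
      rw [Complex.norm_real, Real.norm_eq_abs, abs_of_nonneg hτ.1]
      exact hτ.2
    have hz' : ‖z‖ < 1 + r := by
      rw [mem_ball, dist_eq_norm] at hz
      calc ‖z‖ = ‖(z - τ) + τ‖ := by rw [sub_add_cancel]
        _ ≤ ‖z - τ‖ + ‖(τ : ℂ)‖ := norm_add_le _ _
        _ < r + 1 := by linarith
        _ = 1 + r := add_comm _ _
    calc ‖z‖ * ‖B‖ < (1 + r) * ‖B‖ := by gcongr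
      _ = ‖B‖ + α / 2 := by rw [hr_def]; field_simp
      _ ≤ α := by linarith
  have hΦ : ∀ τ ∈ Icc (0 : ℝ) 1, DifferentiableOn ℂ (fun z : ℂ => f (z • B)) (ball (τ : ℂ) r) :=
    fun τ hτ z hz =>
      ((hf _ (hin τ hτ z hz)).differentiableAt.comp z (differentiableAt_id.smul_const B)).differentiableWithinAt
  have hM : ∀ τ ∈ Icc (0 : ℝ) 1, ∀ z ∈ ball (τ : ℂ) r, ‖(fun z : ℂ => f (z • B)) z‖ ≤ S :=
    fun τ hτ z hz => hS _ (hin τ hτ z hz)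
  have hagree : ∀ τ ∈ Icc (0 : ℝ) 1, ∀ᶠ t : ℝ in 𝓝 τ, f (t • B) = (fun z : ℂ => f (z • B)) (t : ℂ) :=
    fun τ _ => Eventually.of_forall fun t => by
      show f (t • B) = f ((t : ℂ) • B)
      rw [← Complex.coe_algebraMap, algebraMap_smul]
  have key := B12CauchyRemainder354.taylor5_remainder_norm_le isOpen_ball hf5 B hseg hr hΦ hM hagree
  have hsum : ∑ n ∈ Finset.range 5, ((n.factorial : ℝ)⁻¹) • iteratedFDeriv ℝ n f 0 (fun _ => B)
      = f 0 + (iteratedFDeriv ℝ 1 f 0 (fun _ => B) + (2 : ℝ)⁻¹ • iteratedFDeriv ℝ 2 f 0 (fun _ => B)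
        + (6 : ℝ)⁻¹ • iteratedFDeriv ℝ 3 f 0 (fun _ => B) + (24 : ℝ)⁻¹ • iteratedFDeriv ℝ 4 f 0 (fun _ => B)) := by
    simp only [Finset.sum_range_succ, Finset.sum_range_zero, zero_add, Nat.factorial, Nat.cast_one, inv_one,
      one_smul, iteratedFDeriv_zero_apply, mul_one, Nat.cast_mul]
    norm_num
    abel
  rw [hsum, Eq349WardReduction.taylor4_diag_eq] at key
  have hr5 : S / r ^ 5 = 32 * S / α ^ 5 * ‖B‖ ^ 5 := by
    rw [hr_def]
    field_simp
    ring
  rw [hr5] at key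
  have e : f B - (f 0 + (fderiv ℝ f 0 B + (2 : ℝ)⁻¹ • fderiv ℝ (fderiv ℝ f) 0 B B
        + (6 : ℝ)⁻¹ • fderiv ℝ (fderiv ℝ (fderiv ℝ f)) 0 B B B
        + (24 : ℝ)⁻¹ • fderiv ℝ (fderiv ℝ (fderiv ℝ (fderiv ℝ f))) 0 B B B B))
      = f B - f 0 - (fderiv ℝ f 0 B + (2 : ℝ)⁻¹ • fderiv ℝ (fderiv ℝ f) 0 B B
        + (6 : ℝ)⁻¹ • fderiv ℝ (fderiv ℝ (fderiv ℝ f)) 0 B B B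
        + (24 : ℝ)⁻¹ • fderiv ℝ (fderiv ℝ (fderiv ℝ (fderiv ℝ f))) 0 B B B B) := by abel
  rw [e] at key
  exact key

end Remainder

/-! ## §4. The p. 283 claim in the chart, with the tower sizes discharged from (ii) + (2.31) -/

section Chart

open NormedSpace (exp)

variable {𝔄 : Type*} [NormedRing 𝔄] [NormedAlgebra ℝ 𝔄] [CompleteSpace 𝔄] {Λ T : Type*} [Fintype Λ] [Fintype T]
  [AddCommGroup T] {V : Type*} [NormedAddCommGroup V] [NormedSpace ℂ V] {F : Type*} [NormedAddCommGroup F]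
  [NormedSpace ℂ F] [CompleteSpace F]

omit [AddCommGroup T] [NormedSpace ℂ V] in
/-- The size of the whole field from the sizes of its pieces (`‖B‖ ≤ 3aσ`, cf. (I.4.16)). [folklore] -/
private theorem norm_field_le {c ℓ B : Λ → T → V} {a σ τ : ℝ} (ha : 0 ≤ a) (hσ0 : 0 ≤ σ) (hσ1 : σ ≤ 1)
    (hτ1 : τ ≤ 1) (hc : ‖c‖ ≤ a * σ) (hℓ : ‖ℓ‖ ≤ a * σ ^ 2) (hr : ‖B - c - ℓ‖ ≤ a * σ ^ 2 * τ) :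
    ‖B‖ ≤ 3 * a * σ := by
  have e : B = c + ℓ + (B - c - ℓ) := by abel
  have hσ2 : a * σ ^ 2 ≤ a * σ := by
    have : σ ^ 2 ≤ σ := by nlinarith
    exact mul_le_mul_of_nonneg_left this ha
  have h3 : a * σ ^ 2 * τ ≤ a * σ := (mul_le_of_le_one_right (by positivity) hτ1).trans hσ2
  calc ‖B‖ = ‖c + ℓ + (B - c - ℓ)‖ := by rw [← e]
    _ ≤ ‖c‖ + ‖ℓ‖ + ‖B - c - ℓ‖ := norm_add₃_le
    _ ≤ a * σ + a * σ + a * σ := add_le_add (add_le_add hc (hℓ.trans hσ2)) (hr.trans h3)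
    _ = 3 * a * σ := by ring

-- (the quadruply nested operator space over the iterated `Pi` type: one more level of pending instance synthesis)
set_option maxSynthPendingDepth 3 in
/-- **p. 283, the right-hand side of (3.49)-with-𝐑^{(2)}, sizes from (ii) + (2.31)**: in the chart `f(B) = 𝓡(exp ρB)`
of a functional `𝓡` that is `C⁴` at `1` and gauge invariant near `1` (property (iii)) with semisimple charge algebra,
IF `f` is complex-analytic on the ball `‖B‖ < α` with `‖f‖ ≤ S` there (properties (ii) and (2.31) in the chart,
`S = g_j^{κ₀}exp(−κd_j(X))`), then with the field scalings of (I.4.16)–(I.4.18)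
`‖Df(0)B + ½D²f(0)(B,B) + ⅙D³f(0)(B,B,B) + (1/24)D⁴f(0)(B,B,B,B)‖ ≤ (½e₂(a + ½ba²)² + K(e₂,e₃,e₄,a,b))·σ⁴` with the
EXPLICIT Cauchy sizes `e₂ = S(4/α)²`, `e₃ = S(6/α)³`, `e₄ = S(8/α)⁴` — `…Claim283RBound.taylor4_chart_norm_le_of_isSemisimple`
with its three size hypotheses discharged by §2. [cite: Balaban1988Convergent, p.283, (2.31) p.260;
Balaban1987RG1, (4.3)–(4.5) pp.281–282] -/
theorem taylor4_chart_norm_le_of_analytic {𝔤 : Type*} [LieRing 𝔤] [LieAlgebra ℝ 𝔤] [FiniteDimensional ℝ 𝔤]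
    [LieAlgebra.IsSemisimple ℝ 𝔤] (eV : V ≃ₗ[ℝ] 𝔤) {ℰ : (Λ → T → 𝔄) → F} (e : Λ → T) (ρ : V →L[ℝ] 𝔄)
    (hρ : ∀ a b : V, ρ (eV.symm ⁅eV a, eV b⁆) = ρ a * ρ b - ρ b * ρ a) (hℰ : ContDiffAt ℝ 4 ℰ 1)
    (h47 : ∀ lam : T → V, ∀ᶠ W in 𝓝 (1 : Λ → T → 𝔄), ∀ᶠ t in 𝓝 (0 : ℝ),
      ℰ (fun ν x => exp (t • ρ (lam x)) * W ν x * exp (-(t • ρ (lam (x + e ν))))) = ℰ W)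
    {α S : ℝ} (hα : 0 < α)
    (hf : AnalyticOnNhd ℂ (fun A : Λ → T → V => ℰ (fun ν y => exp (ρ (A ν y)))) (ball 0 α))
    (hS : ∀ A ∈ ball (0 : Λ → T → V) α, ‖ℰ (fun ν y => exp (ρ (A ν y)))‖ ≤ S)
    {b : ℝ} (hb0 : 0 ≤ b) (hb : ∀ x y : V, ‖eV.symm ⁅eV x, eV y⁆‖ ≤ b * ‖x‖ * ‖y‖)
    (lam : T → V) (c ℓ B : Λ → T → V) (hc : ∀ ν y, lam (y + e ν) - lam y = c ν y)
    {a σ τ : ℝ} (ha : 0 ≤ a) (hσ0 : 0 ≤ σ) (hσ1 : σ ≤ 1) (hστ : σ ≤ τ) (hτ1 : τ ≤ 1) (hcn : ‖c‖ ≤ a * σ)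
    (hlam : ‖lam‖ ≤ a * σ) (hℓ : ‖ℓ‖ ≤ a * σ ^ 2) (hr : ‖B - c - ℓ‖ ≤ a * σ ^ 2 * τ) :
    ‖fderiv ℝ (fun A : Λ → T → V => ℰ (fun ν y => exp (ρ (A ν y)))) 0 B
        + (2 : ℝ)⁻¹ • fderiv ℝ (fderiv ℝ (fun A : Λ → T → V => ℰ (fun ν y => exp (ρ (A ν y))))) 0 B B
        + (6 : ℝ)⁻¹ • fderiv ℝ (fderiv ℝ (fderiv ℝ (fun A : Λ → T → V => ℰ (fun ν y => exp (ρ (A ν y)))))) 0 B B B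
        + (24 : ℝ)⁻¹ • fderiv ℝ (fderiv ℝ (fderiv ℝ (fderiv ℝ
            (fun A : Λ → T → V => ℰ (fun ν y => exp (ρ (A ν y))))))) 0 B B B B‖
      ≤ ((2 : ℝ)⁻¹ * (S * (4 / α) ^ 2) * (a + (2 : ℝ)⁻¹ * b * a ^ 2) ^ 2
        + ((3 / 2 : ℝ) * (S * (4 / α) ^ 2) * a ^ 2 + (10 / 3 : ℝ) * (S * (4 / α) ^ 2) * a ^ 3 * b
          + (9 / 8 : ℝ) * (S * (4 / α) ^ 2) * a ^ 4 * b ^ 2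
          + (5 / 2 : ℝ) * (S * (6 / α) ^ 3) * a ^ 3 + (33 / 8 : ℝ) * (S * (6 / α) ^ 3) * a ^ 4 * b
          + (9 / 4 : ℝ) * (S * (8 / α) ^ 4) * a ^ 4)) * σ ^ 4 := by
  have hS0 : 0 ≤ S := (norm_nonneg _).trans (hS 0 (mem_ball_self hα))
  exact Claim283RBound.taylor4_chart_norm_le_of_isSemisimple eV e ρ hρ hℰ h47 (by positivity) (by positivity)
    (by positivity) (fun u v => norm_fderiv₂_real_le hα hf hS u v) (fun u v w => norm_fderiv₃_real_le hα hf hS u v w)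
    (fun u v w x => norm_fderiv₄_real_le hα hf hS u v w x) hb0 hb lam c ℓ B hc ha hσ0 hσ1 hστ hτ1 hcn hlam hℓ hr

-- (the quadruply nested operator space over the iterated `Pi` type: one more level of pending instance synthesis)
set_option maxSynthPendingDepth 3 in
/-- **p. 283, the per-domain difference, NO lettered size left**: under the hypotheses of
`taylor4_chart_norm_le_of_analytic` and `‖B‖ ≤ α/2` («for g_j sufficiently small»), the difference
`f(B) − f(0)` (model: `𝐑^{(j)}(X, U_k) − 𝐑^{(j)}(X, 1)` in the chart around the trivial configuration) obeys
`‖f(B) − f(0)‖ ≤ C(a, b, α)·σ⁴·S`, `σ = LʲL⁻ⁿ`, with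
`C = ½k₂(a + ½ba²)² + (3/2)k₂a² + (10/3)k₂a³b + (9/8)k₂a⁴b² + (5/2)k₃a³ + (33/8)k₃a⁴b + (9/4)k₄a⁴ + 243k₅a⁵`,
`k₂ = (4/α)²`, `k₃ = (6/α)³`, `k₄ = (8/α)⁴`, `k₅ = 32/α⁵` — print's «O(1)(LʲL⁻ⁿ)⁴g_j^{κ₀}exp(−κd_j(X))» at
`S = g_j^{κ₀}exp(−κd_j(X))`, the O(1) explicit (fourth-order part: §2 + the companion file; fifth-order remainder: §3,
`‖B‖ ≤ 3aσ`, `σ⁵ ≤ σ⁴`). [cite: Balaban1988Convergent, p.283, (2.31) p.260; Balaban1987RG1, (4.5) p.282, (3.54) p.280] -/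
theorem diff_chart_norm_le_of_analytic {𝔤 : Type*} [LieRing 𝔤] [LieAlgebra ℝ 𝔤] [FiniteDimensional ℝ 𝔤]
    [LieAlgebra.IsSemisimple ℝ 𝔤] (eV : V ≃ₗ[ℝ] 𝔤) {ℰ : (Λ → T → 𝔄) → F} (e : Λ → T) (ρ : V →L[ℝ] 𝔄)
    (hρ : ∀ a b : V, ρ (eV.symm ⁅eV a, eV b⁆) = ρ a * ρ b - ρ b * ρ a) (hℰ : ContDiffAt ℝ 4 ℰ 1)
    (h47 : ∀ lam : T → V, ∀ᶠ W in 𝓝 (1 : Λ → T → 𝔄), ∀ᶠ t in 𝓝 (0 : ℝ),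
      ℰ (fun ν x => exp (t • ρ (lam x)) * W ν x * exp (-(t • ρ (lam (x + e ν))))) = ℰ W)
    {α S : ℝ} (hα : 0 < α)
    (hf : AnalyticOnNhd ℂ (fun A : Λ → T → V => ℰ (fun ν y => exp (ρ (A ν y)))) (ball 0 α))
    (hS : ∀ A ∈ ball (0 : Λ → T → V) α, ‖ℰ (fun ν y => exp (ρ (A ν y)))‖ ≤ S)
    {b : ℝ} (hb0 : 0 ≤ b) (hb : ∀ x y : V, ‖eV.symm ⁅eV x, eV y⁆‖ ≤ b * ‖x‖ * ‖y‖)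
    (lam : T → V) (c ℓ B : Λ → T → V) (hc : ∀ ν y, lam (y + e ν) - lam y = c ν y)
    {a σ τ : ℝ} (ha : 0 ≤ a) (hσ0 : 0 ≤ σ) (hσ1 : σ ≤ 1) (hστ : σ ≤ τ) (hτ1 : τ ≤ 1) (hcn : ‖c‖ ≤ a * σ)
    (hlam : ‖lam‖ ≤ a * σ) (hℓ : ‖ℓ‖ ≤ a * σ ^ 2) (hr : ‖B - c - ℓ‖ ≤ a * σ ^ 2 * τ) (hBα : ‖B‖ ≤ α / 2) :
    ‖ℰ (fun ν y => exp (ρ (B ν y))) - ℰ (fun ν y => exp (ρ ((0 : Λ → T → V) ν y)))‖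
      ≤ ((2 : ℝ)⁻¹ * (4 / α) ^ 2 * (a + (2 : ℝ)⁻¹ * b * a ^ 2) ^ 2
          + (3 / 2 : ℝ) * (4 / α) ^ 2 * a ^ 2 + (10 / 3 : ℝ) * (4 / α) ^ 2 * a ^ 3 * b
          + (9 / 8 : ℝ) * (4 / α) ^ 2 * a ^ 4 * b ^ 2
          + (5 / 2 : ℝ) * (6 / α) ^ 3 * a ^ 3 + (33 / 8 : ℝ) * (6 / α) ^ 3 * a ^ 4 * b
          + (9 / 4 : ℝ) * (8 / α) ^ 4 * a ^ 4 + 243 * (32 / α ^ 5) * a ^ 5) * σ ^ 4 * S := by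
  have hS0 : 0 ≤ S := (norm_nonneg _).trans (hS 0 (mem_ball_self hα))
  have hT := taylor4_chart_norm_le_of_analytic eV e ρ hρ hℰ h47 hα hf hS hb0 hb lam c ℓ B hc ha hσ0 hσ1 hστ hτ1
    hcn hlam hℓ hr
  have h5 := taylor5_remainder_real_norm_le hα hf hS hBα
  have hB : ‖B‖ ≤ 3 * a * σ := norm_field_le ha hσ0 hσ1 hτ1 hcn hℓ hr
  have hB5 : 32 * S / α ^ 5 * ‖B‖ ^ 5 ≤ 243 * (32 / α ^ 5) * a ^ 5 * σ ^ 4 * S := by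
    have h1 : ‖B‖ ^ 5 ≤ (3 * a * σ) ^ 5 := by gcongr
    have hσ5 : σ ^ 5 ≤ σ ^ 4 := pow_le_pow_of_le_one hσ0 hσ1 (by norm_num)
    have hk : 0 ≤ 32 * S / α ^ 5 := by positivity
    calc 32 * S / α ^ 5 * ‖B‖ ^ 5 ≤ 32 * S / α ^ 5 * (3 * a * σ) ^ 5 := mul_le_mul_of_nonneg_left h1 hk
      _ = 243 * (32 / α ^ 5) * a ^ 5 * S * σ ^ 5 := by ring
      _ ≤ 243 * (32 / α ^ 5) * a ^ 5 * S * σ ^ 4 := mul_le_mul_of_nonneg_left hσ5 (by positivity)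
      _ = 243 * (32 / α ^ 5) * a ^ 5 * σ ^ 4 * S := by ring
  set f : (Λ → T → V) → F := fun A => ℰ (fun ν y => exp (ρ (A ν y))) with hf_def
  set P : F := fderiv ℝ f 0 B + (2 : ℝ)⁻¹ • fderiv ℝ (fderiv ℝ f) 0 B B
      + (6 : ℝ)⁻¹ • fderiv ℝ (fderiv ℝ (fderiv ℝ f)) 0 B B B
      + (24 : ℝ)⁻¹ • fderiv ℝ (fderiv ℝ (fderiv ℝ (fderiv ℝ f))) 0 B B B B with hP
  have e1 : f B - f 0 = P + (f B - f 0 - P) := by abel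
  show ‖f B - f 0‖ ≤ _
  calc ‖f B - f 0‖ = ‖P + (f B - f 0 - P)‖ := by rw [← e1]
    _ ≤ ‖P‖ + ‖f B - f 0 - P‖ := norm_add_le _ _
    _ ≤ _ + 243 * (32 / α ^ 5) * a ^ 5 * σ ^ 4 * S := add_le_add hT (h5.trans hB5)
    _ = _ := by ring

-- (the quadruply nested operator space over the iterated `Pi` type: one more level of pending instance synthesis)
set_option maxSynthPendingDepth 3 in
/-- **«bounded by O(1)(LʲL⁻ⁿ)⁴g_j^{κ₀}exp(−κd_j(X))», the O(1) explicit and NO lettered size**: the previous theorem at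
print's `S = g_j^{κ₀}exp(−κd_j(X))` of (2.31) — `‖f(B) − f(0)‖ ≤ C(a,b,α)·(LʲL⁻ⁿ)⁴·g_j^{κ₀}·exp(−κd_j(X))`, the per-domain
feed of `…B14.Claim283RBound.perPointR_of_eq349` / `…B14.Thm2Assembly.perPointR_of_domainBound` («and this yields the
inequality (2.44)»). [cite: Balaban1988Convergent, p.283, (2.31) p.260, (2.44) p.263] -/
theorem diff_chart_norm_le_coupling_of_analytic {𝔤 : Type*} [LieRing 𝔤] [LieAlgebra ℝ 𝔤] [FiniteDimensional ℝ 𝔤]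
    [LieAlgebra.IsSemisimple ℝ 𝔤] (eV : V ≃ₗ[ℝ] 𝔤) {ℰ : (Λ → T → 𝔄) → F} (e : Λ → T) (ρ : V →L[ℝ] 𝔄)
    (hρ : ∀ a b : V, ρ (eV.symm ⁅eV a, eV b⁆) = ρ a * ρ b - ρ b * ρ a) (hℰ : ContDiffAt ℝ 4 ℰ 1)
    (h47 : ∀ lam : T → V, ∀ᶠ W in 𝓝 (1 : Λ → T → 𝔄), ∀ᶠ t in 𝓝 (0 : ℝ),
      ℰ (fun ν x => exp (t • ρ (lam x)) * W ν x * exp (-(t • ρ (lam (x + e ν))))) = ℰ W)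
    {α : ℝ} (hα : 0 < α) {g κ dX : ℝ} {κ₀ : ℕ}
    (hf : AnalyticOnNhd ℂ (fun A : Λ → T → V => ℰ (fun ν y => exp (ρ (A ν y)))) (ball 0 α))
    (hS : ∀ A ∈ ball (0 : Λ → T → V) α, ‖ℰ (fun ν y => exp (ρ (A ν y)))‖ ≤ g ^ κ₀ * Real.exp (-κ * dX))
    {b : ℝ} (hb0 : 0 ≤ b) (hb : ∀ x y : V, ‖eV.symm ⁅eV x, eV y⁆‖ ≤ b * ‖x‖ * ‖y‖)
    (lam : T → V) (c ℓ B : Λ → T → V) (hc : ∀ ν y, lam (y + e ν) - lam y = c ν y)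
    {a σ τ : ℝ} (ha : 0 ≤ a) (hσ0 : 0 ≤ σ) (hσ1 : σ ≤ 1) (hστ : σ ≤ τ) (hτ1 : τ ≤ 1) (hcn : ‖c‖ ≤ a * σ)
    (hlam : ‖lam‖ ≤ a * σ) (hℓ : ‖ℓ‖ ≤ a * σ ^ 2) (hr : ‖B - c - ℓ‖ ≤ a * σ ^ 2 * τ) (hBα : ‖B‖ ≤ α / 2) :
    ‖ℰ (fun ν y => exp (ρ (B ν y))) - ℰ (fun ν y => exp (ρ ((0 : Λ → T → V) ν y)))‖
      ≤ ((2 : ℝ)⁻¹ * (4 / α) ^ 2 * (a + (2 : ℝ)⁻¹ * b * a ^ 2) ^ 2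
          + (3 / 2 : ℝ) * (4 / α) ^ 2 * a ^ 2 + (10 / 3 : ℝ) * (4 / α) ^ 2 * a ^ 3 * b
          + (9 / 8 : ℝ) * (4 / α) ^ 2 * a ^ 4 * b ^ 2
          + (5 / 2 : ℝ) * (6 / α) ^ 3 * a ^ 3 + (33 / 8 : ℝ) * (6 / α) ^ 3 * a ^ 4 * b
          + (9 / 4 : ℝ) * (8 / α) ^ 4 * a ^ 4 + 243 * (32 / α ^ 5) * a ^ 5)
        * σ ^ 4 * g ^ κ₀ * Real.exp (-κ * dX) := by
  have h := diff_chart_norm_le_of_analytic eV e ρ hρ hℰ h47 hα hf hS hb0 hb lam c ℓ B hc ha hσ0 hσ1 hστ hτ1 hcn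
    hlam hℓ hr hBα
  simpa only [mul_assoc] using h

-- (the quadruply nested operator space over the iterated `Pi` type: one more level of pending instance synthesis)
omit [CompleteSpace 𝔄] [AddCommGroup T] in
set_option maxSynthPendingDepth 3 in
/-- **𝐄-side twin — «(the irrelevant terms) … can be bounded by O((LʲL⁻ⁿ)^{5−β})» (p. 281) with the sizes from
(ii) + (iv)**: the fourteen remainder terms of (3.49) in the chart `f(B) = 𝓔(exp ρB)` (the right-hand side of
`…B14.Eq349WardReduction.eq349_chart_of_isSemisimple` minus its main term; pure power counting — no gauge invariance,
no semisimplicity needed here), for `f` complex-analytic on `‖B‖ < α` with `‖f‖ ≤ S` there (for 𝐄^{(j)}(X, ·, z):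
(2.27)(ii) and (iv) = (I.1.18), `S = E₀exp(−κd_j(X))`; for 𝐑^{(j)}: (2.31)), obey `‖R₁ + ⋯ + R₁₄‖ ≤ K·σ⁴τ` with
`K = (3/2)e₂a² + (10/3)e₂a³b + (9/8)e₂a⁴b² + (5/2)e₃a³ + (33/8)e₃a⁴b + (9/4)e₄a⁴` at the EXPLICIT Cauchy sizes
`e₂ = S(4/α)²`, `e₃ = S(6/α)³`, `e₄ = S(8/α)⁴` — `…Eq349WardReduction.remainder349_norm_le` with its size hypotheses
discharged by §2. [cite: Balaban1988Convergent, (3.49) p.280, p.281, (2.27) p.259, (2.31) p.260; Balaban1987RG1,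
(4.3)–(4.5) pp.281–282] -/
theorem remainder349_chart_norm_le_of_analytic {𝔤 : Type*} [LieRing 𝔤] [LieAlgebra ℝ 𝔤] (eV : V ≃ₗ[ℝ] 𝔤)
    {ℰ : (Λ → T → 𝔄) → F} (ρ : V →L[ℝ] 𝔄) {α S : ℝ} (hα : 0 < α)
    (hf : AnalyticOnNhd ℂ (fun A : Λ → T → V => ℰ (fun ν y => exp (ρ (A ν y)))) (ball 0 α))
    (hS : ∀ A ∈ ball (0 : Λ → T → V) α, ‖ℰ (fun ν y => exp (ρ (A ν y)))‖ ≤ S)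
    {b : ℝ} (hb0 : 0 ≤ b) (hb : ∀ x y : V, ‖eV.symm ⁅eV x, eV y⁆‖ ≤ b * ‖x‖ * ‖y‖)
    (lam : T → V) (c ℓ B : Λ → T → V)
    {a σ τ : ℝ} (ha : 0 ≤ a) (hσ0 : 0 ≤ σ) (hσ1 : σ ≤ 1) (hστ : σ ≤ τ) (hτ1 : τ ≤ 1) (hcn : ‖c‖ ≤ a * σ)
    (hlam : ‖lam‖ ≤ a * σ) (hℓ : ‖ℓ‖ ≤ a * σ ^ 2) (hr : ‖B - c - ℓ‖ ≤ a * σ ^ 2 * τ) :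
    ‖fderiv ℝ (fderiv ℝ (fun A : Λ → T → V => ℰ (fun ν y => exp (ρ (A ν y))))) 0 ℓ (B - c - ℓ)
        + (2 : ℝ)⁻¹ • fderiv ℝ (fderiv ℝ (fun A : Λ → T → V => ℰ (fun ν y => exp (ρ (A ν y))))) 0 (B - c - ℓ) (B - c - ℓ)
        + (3 : ℝ)⁻¹ • fderiv ℝ (fderiv ℝ (fun A : Λ → T → V => ℰ (fun ν y => exp (ρ (A ν y))))) 0 (B - c - ℓ)
            (fun ν y => eV.symm ⁅eV (lam y), eV (c ν y)⁆)
        + (3 : ℝ)⁻¹ • fderiv ℝ (fderiv ℝ (fun A : Λ → T → V => ℰ (fun ν y => exp (ρ (A ν y))))) 0 (B - c)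
            (fun ν y => eV.symm ⁅eV (lam y), eV ((B - c) ν y)⁆ - (2 : ℝ)⁻¹ • eV.symm ⁅eV ((B - c) ν y), eV (c ν y)⁆)
        + (6 : ℝ)⁻¹ • fderiv ℝ (fderiv ℝ (fderiv ℝ (fun A : Λ → T → V => ℰ (fun ν y => exp (ρ (A ν y)))))) 0 B B (B - c - ℓ)
        + (6 : ℝ)⁻¹ • fderiv ℝ (fderiv ℝ (fderiv ℝ (fun A : Λ → T → V => ℰ (fun ν y => exp (ρ (A ν y)))))) 0 ℓ B (B - c)
        + (6 : ℝ)⁻¹ • fderiv ℝ (fderiv ℝ (fun A : Λ → T → V => ℰ (fun ν y => exp (ρ (A ν y))))) 0 ℓ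
            (fun ν y => eV.symm ⁅eV (lam y), eV ((B - c) ν y)⁆ - (2 : ℝ)⁻¹ • eV.symm ⁅eV ((B - c) ν y), eV (c ν y)⁆)
        + (6 : ℝ)⁻¹ • fderiv ℝ (fderiv ℝ (fun A : Λ → T → V => ℰ (fun ν y => exp (ρ (A ν y))))) 0 (B - c)
            (fun ν y => eV.symm ⁅eV (lam y), eV (ℓ ν y)⁆ - (2 : ℝ)⁻¹ • eV.symm ⁅eV (ℓ ν y), eV (c ν y)⁆)
        + (8 : ℝ)⁻¹ • fderiv ℝ (fderiv ℝ (fun A : Λ → T → V => ℰ (fun ν y => exp (ρ (A ν y))))) 0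
            (fun ν y => eV.symm ⁅eV (lam y), eV (c ν y)⁆)
            (fun ν y => eV.symm ⁅eV (lam y), eV ((B - c) ν y)⁆ - (2 : ℝ)⁻¹ • eV.symm ⁅eV ((B - c) ν y), eV (c ν y)⁆)
        + (8 : ℝ)⁻¹ • fderiv ℝ (fderiv ℝ (fun A : Λ → T → V => ℰ (fun ν y => exp (ρ (A ν y))))) 0 (B - c)
            (fun ν y => eV.symm ⁅eV (lam y), eV (eV.symm ⁅eV (lam y), eV (c ν y)⁆)⁆
              - (2 : ℝ)⁻¹ • eV.symm ⁅eV (eV.symm ⁅eV (lam y), eV (c ν y)⁆), eV (c ν y)⁆)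
        + (8 : ℝ)⁻¹ • fderiv ℝ (fderiv ℝ (fderiv ℝ (fun A : Λ → T → V => ℰ (fun ν y => exp (ρ (A ν y)))))) 0
            (fun ν y => eV.symm ⁅eV (lam y), eV (c ν y)⁆) B (B - c)
        + (8 : ℝ)⁻¹ • fderiv ℝ (fderiv ℝ (fderiv ℝ (fun A : Λ → T → V => ℰ (fun ν y => exp (ρ (A ν y)))))) 0 B B
            (fun ν y => eV.symm ⁅eV (lam y), eV ((B - c) ν y)⁆ - (2 : ℝ)⁻¹ • eV.symm ⁅eV ((B - c) ν y), eV (c ν y)⁆)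
        - (48 : ℝ)⁻¹ • fderiv ℝ (fderiv ℝ (fun A : Λ → T → V => ℰ (fun ν y => exp (ρ (A ν y))))) 0 B
            (fun ν y => eV.symm ⁅eV (B ν y), eV (eV.symm ⁅eV ((B - c) ν y), eV (c ν y)⁆)⁆)
        + (24 : ℝ)⁻¹ • fderiv ℝ (fderiv ℝ (fderiv ℝ (fderiv ℝ (fun A : Λ → T → V => ℰ (fun ν y => exp (ρ (A ν y))))))) 0 B B B (B - c)‖
      ≤ ((3 / 2 : ℝ) * (S * (4 / α) ^ 2) * a ^ 2 + (10 / 3 : ℝ) * (S * (4 / α) ^ 2) * a ^ 3 * b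
          + (9 / 8 : ℝ) * (S * (4 / α) ^ 2) * a ^ 4 * b ^ 2
          + (5 / 2 : ℝ) * (S * (6 / α) ^ 3) * a ^ 3 + (33 / 8 : ℝ) * (S * (6 / α) ^ 3) * a ^ 4 * b
          + (9 / 4 : ℝ) * (S * (8 / α) ^ 4) * a ^ 4) * σ ^ 4 * τ := by
  have hS0 : 0 ≤ S := (norm_nonneg _).trans (hS 0 (mem_ball_self hα))
  have key := Eq349WardReduction.remainder349_norm_le (fderiv ℝ (fderiv ℝ (fun A : Λ → T → V => ℰ (fun ν y => exp (ρ (A ν y))))) 0) (fderiv ℝ (fderiv ℝ (fderiv ℝ (fun A : Λ → T → V => ℰ (fun ν y => exp (ρ (A ν y)))))) 0)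
    (fderiv ℝ (fderiv ℝ (fderiv ℝ (fderiv ℝ (fun A : Λ → T → V => ℰ (fun ν y => exp (ρ (A ν y))))))) 0)
    (show 0 ≤ S * (4 / α) ^ 2 by positivity) (show 0 ≤ S * (6 / α) ^ 3 by positivity)
    (show 0 ≤ S * (8 / α) ^ 4 by positivity)
    (fun u v => norm_fderiv₂_real_le hα hf hS u v) (fun u v w => norm_fderiv₃_real_le hα hf hS u v w)
    (fun u v w x => norm_fderiv₄_real_le hα hf hS u v w x)
    (LinearMap.mk₂ ℝ (fun a b => eV.symm ⁅eV a, eV b⁆) (fun _ _ _ => by simp) (fun _ _ _ => by simp)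
      (fun _ _ _ => by simp) (fun _ _ _ => by simp)) hb0 (fun x y => by simpa only [LinearMap.mk₂_apply] using hb x y)
    lam c ℓ B ha hσ0 hσ1 hστ hτ1 hcn hlam hℓ hr
  simpa only [LinearMap.mk₂_apply] using key

end Chart

end Literature.MathematicalPhysics.QuantumFieldTheory.Balaban1983to89.B14.Claim283RAnalytic
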